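import Summits.AtomisticToContinuum.BoseEinsteinCondensation.Theses.BECNudgeWalk
import Literature.MathematicalPhysics.QuantumManyBody.LiebYngvasonTheorem
import Literature.MathematicalPhysics.QuantumManyBody.BoseGasThermodynamicLimitRuelle
import Literature.MathematicalPhysics.QuantumManyBody.BoseGasDirichletWall

/-!
# The Lieb–Yngvason lower bound in thermodynamic-limit form (Stub A of `NudgedCondensation`)

Route `BECNudgeWalk`, crux `NudgedCondensation` (stmt-AtomisticToContinuum-14362), line `registered`
(skeleton `Lines/birth.lean`), stub `stub_lowerBoundTL`.

The crux compares the nudged functional at a condensed Dirichlet trial state with the Dirichlet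
ground-state energy `E₀^D(N, L)` in the box of side `L = sideLength ρ N = (N/ρ)^{1/3}`; its first
half is the LOWER bound `E₀^D(N, (N/ρ)^{1/3}) ≥ 4πρa(1−η)N` (`a = (scatteringLength v).toReal`) for
every `η > 0`, all densities `0 < ρ < ρ₀(v, η)` and all large `N`.  This file proves exactly that
statement (`stub_lowerBoundTL`) from the in-tree finite-box form of [LSSY2005, Thm. 2.4 (2.35)],
`LSSY2005_lowerBound_dirichlet_holds`:
`E₀^D(N, L) ≥ 4πρa(1 − C·Y^{1/17})N` with `ρ = N/L³`, `Y = 4πρa³/3`, valid once `Y < δ` and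
`L/a > C'·Y^{-6/17}`.

Mechanism.  If `a = 0` the claimed lower bound is `0` and there is nothing to prove.  If `a > 0`,
choose the density threshold `ρ₀` so small that `Y = (4πa³/3)·ρ < δ` and `C·Y^{1/17} ≤ η` for all
`ρ < ρ₀` (`exists_density_threshold_rpow17`: `ρ₀ = min(δ/2, (η/C)^17) / (4πa³/3)`); at fixed such
`ρ` the side length `L_N = (N/ρ)^{1/3} → ∞` (`tendsto_sideLength_atTop`), so eventually
`L_N/a > C'·Y^{-6/17}`, while `N/L_N³ = ρ` exactly (`div_sideLength_pow_three`).  The finite-box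
bound then gives `E₀^D ≥ 4πρa(1 − C·Y^{1/17})N ≥ 4πρa(1 − η)N`.

References: [LSSY2005] E.H. Lieb, R. Seiringer, J.P. Solovej, J. Yngvason, *The Mathematics of the
Bose Gas and its Condensation* (2005), Thm. 2.4, eq. (2.35); [LiebYngvason1998].
-/

noncomputable section

namespace Summit.AtomisticToContinuum.BoseEinsteinCondensation.NudgedCondensationLine

open Filter
open scoped ENNReal
open Literature.MathematicalPhysics.QuantumManyBody.BoseGas

/-- **Density threshold.**  For `K, δ, C, η > 0` there is `ρ₀ > 0` such that for all
`0 < ρ < ρ₀` the number `Y = K·ρ` satisfies `Y < δ` and `C·Y^{1/17} ≤ η`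
(take `ρ₀ = min(δ/2, (η/C)^17)/K`, so that `Y < min(δ/2, (η/C)^17)` and
`Y^{1/17} ≤ ((η/C)^17)^{1/17} = η/C`). [folklore] -/
theorem exists_density_threshold_rpow17 {K δ C η : ℝ} (hK : 0 < K) (hδ : 0 < δ) (hC : 0 < C)
    (hη : 0 < η) :
    ∃ ρ₀ : ℝ, 0 < ρ₀ ∧ ∀ ρ : ℝ, 0 < ρ → ρ < ρ₀ →
      K * ρ < δ ∧ C * (K * ρ) ^ ((1 : ℝ) / 17) ≤ η := by
  have hηC : 0 < η / C := div_pos hη hC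
  set t : ℝ := min (δ / 2) ((η / C) ^ 17) with ht_def
  have ht : 0 < t := lt_min (half_pos hδ) (pow_pos hηC 17)
  refine ⟨t / K, div_pos ht hK, fun ρ hρ hρt => ?_⟩
  have hKρ : K * ρ < t := by
    rw [mul_comm]
    exact (lt_div_iff₀ hK).1 hρt
  have hY0 : 0 ≤ K * ρ := (mul_pos hK hρ).le
  refine ⟨(hKρ.trans_le (min_le_left _ _)).trans (half_lt_self hδ), ?_⟩
  have h17 : ((η / C) ^ 17) ^ ((1 : ℝ) / 17) = η / C := by
    rw [show ((1 : ℝ) / 17) = ((17 : ℕ) : ℝ)⁻¹ by norm_num]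
    exact Real.pow_rpow_inv_natCast hηC.le (by norm_num)
  have h1 : (K * ρ) ^ ((1 : ℝ) / 17) ≤ η / C := by
    calc (K * ρ) ^ ((1 : ℝ) / 17) ≤ ((η / C) ^ 17) ^ ((1 : ℝ) / 17) :=
          Real.rpow_le_rpow hY0 (hKρ.le.trans (min_le_right _ _)) (by norm_num)
      _ = η / C := h17
  exact (mul_le_mul_of_nonneg_left h1 hC.le).trans_eq (mul_div_cancel₀ η hC.ne')

/-- **Stub A (Lieb–Yngvason lower bound, thermodynamic-limit form).**  For a repulsive finite-range
pair potential `v` with finite scattering length `a = (scatteringLength v).toReal` and every `η > 0`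
there is `ρ₀ > 0` such that for `0 < ρ < ρ₀` and all large `N`:
`E₀^D(N, (N/ρ)^{1/3}) ≥ 4πρa(1−η)N`.  Obtained from the finite-box bound
`LSSY2005_lowerBound_dirichlet_holds` (`E₀^D(N,L) ≥ 4πρa(1 − C·Y^{1/17})N`, `ρ = N/L³`,
`Y = 4πρa³/3 < δ`, `L/a > C'·Y^{-6/17}`) by choosing `ρ₀` with `C·Y^{1/17} ≤ η`
(`exists_density_threshold_rpow17`), `N/L³ = ρ` (`div_sideLength_pow_three`) and `L_N → ∞`
(`tendsto_sideLength_atTop`); trivially true when `a = 0`. [cite: LSSY2005, Thm. 2.4 (2.35)] -/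
theorem stub_lowerBoundTL :
    ∀ v : ℝ → ENNReal, IsRepulsiveFiniteRange v → scatteringLength v ≠ ⊤ →
      ∀ η : ℝ, 0 < η → ∃ ρ₀ : ℝ, 0 < ρ₀ ∧ ∀ ρ : ℝ, 0 < ρ → ρ < ρ₀ →
        ∀ᶠ N : ℕ in Filter.atTop,
          ENNReal.ofReal (4 * Real.pi * ρ * (scatteringLength v).toReal * (1 - η) * N) ≤
            groundStateEnergy v N (sideLength ρ N) := by
  intro v hv hatop η hη
  rcases (ENNReal.toReal_nonneg : 0 ≤ (scatteringLength v).toReal).eq_or_lt with ha | ha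
  · -- `a = 0`: the claimed lower bound is `0`.
    refine ⟨1, one_pos, fun ρ _ _ => Filter.Eventually.of_forall fun N => ?_⟩
    rw [← ha, mul_zero, zero_mul, zero_mul, ENNReal.ofReal_zero]
    exact zero_le
  · -- `a > 0`: the finite-box bound of [LSSY2005, Thm. 2.4] at `L = (N/ρ)^{1/3}`.
    obtain ⟨δ, C, C', hδ, hC, _hC', h⟩ := LSSY2005_lowerBound_dirichlet_holds v hv hatop
    set a : ℝ := (scatteringLength v).toReal with ha_def
    have hK : 0 < 4 * Real.pi * a ^ 3 / 3 :=
      div_pos (mul_pos (mul_pos (by norm_num) Real.pi_pos) (pow_pos ha 3)) (by norm_num)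
    obtain ⟨ρ₀, hρ₀, hρ₀'⟩ := exists_density_threshold_rpow17 hK hδ hC hη
    refine ⟨ρ₀, hρ₀, fun ρ hρ hρlt => ?_⟩
    obtain ⟨hYδ, hCY⟩ := hρ₀' ρ hρ hρlt
    have hY : 4 * Real.pi * ρ * a ^ 3 / 3 = 4 * Real.pi * a ^ 3 / 3 * ρ := by ring
    filter_upwards [eventually_gt_atTop 0,
      (tendsto_sideLength_atTop hρ).eventually_gt_atTop
        (C' * (4 * Real.pi * ρ * a ^ 3 / 3) ^ (-(6 : ℝ) / 17) * a)] with N hN hbig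
    have hL : 0 < sideLength ρ N := sideLength_pos_of_pos hρ hN
    have key := h N (sideLength ρ N) hL
    dsimp only at key
    rw [div_sideLength_pow_three hρ hN] at key
    have key' := key (by rwa [hY]) ((lt_div_iff₀ ha).2 hbig)
    refine le_trans (ENNReal.ofReal_le_ofReal ?_) key'
    have h1 : 1 - η ≤ 1 - C * (4 * Real.pi * ρ * a ^ 3 / 3) ^ ((1 : ℝ) / 17) := by
      rw [hY]; linarith
    have h0 : 0 ≤ 4 * Real.pi * ρ * a :=
      (mul_pos (mul_pos (mul_pos (by norm_num) Real.pi_pos) hρ) ha).le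
    exact mul_le_mul_of_nonneg_right (mul_le_mul_of_nonneg_left h1 h0) N.cast_nonneg

end Summit.AtomisticToContinuum.BoseEinsteinCondensation.NudgedCondensationLine

end
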